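import Literature.NumberTheory.EllipticCurves.Rubin1991.TwoVariableMainConjecture
import HarnessLib

/-!
# Restriction of the two-variable Katz–de Shalit frame along the line `T₂ = 0` (inner variable killed)
# (helper file 5 for crux 2 `GoodLatticeBDPValue`, stmt-BirchSwinnertonDyer-19032, cell `bsd-eis` seat `bsd-eis-k5-c2`)

The typer's file `Literature/…/Rubin1991/TwoVariableMainConjecture.lean` (k5-ty g3, p438535) reads
`G ∈ 𝒪_{ℂ_p}⟦T₁⟧⟦T₂⟧ = PowerSeries (PowerSeries (PadicComplexInt p))` with OUTER variable `T₁ ↔ γ₁`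
and INNER `T₂ ↔ γ₂`, and proves the analytic restriction to the line `T₁ = 0`
(`IsKatzMeasure₂.isKatzBranch_constantCoeff`: `G(0, T₂) = PowerSeries.constantCoeff G` is the
one-variable `κ₂`-branch), leaving the other line as the bare unfolding `hasValueAt₂_zero_right`
("the substituted series is not constructed here").  The ALGEBRAIC descent landed by this seat
(`EisensteinPrimesTwoVariableDescent.descent_iwasawaAlgebra`, p445633) kills the INNER variable
(`π = PowerSeries.map PowerSeries.constantCoeff`), so the analytic half it pairs with is the
restriction to `T₂ = 0`: the substituted series IS `PowerSeries.map PowerSeries.constantCoeff G`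
(`G(T₁, 0)`), constructed here, with

* `hasValueAt₂_zero_right_iff` : `G` has value `v` at `(x, 0)` iff `G(·, 0) = G.map constantCoeff`
  has value `v` at `x` (only the terms `j = 0` of the double sum survive);
* `isKatzBranch_map_constantCoeff` : if `G` is the `λ`-twisted two-variable frame for
  `(κ₁, κ₂; γ₁, γ₂)` and `κ₁(γ₂) = 0`, then `G(T₁, 0)` is the one-variable `λ`-twisted `κ₁`-branch
  `DeShalit1987.IsKatzBranch … κ₁ γ₁ … (G.map constantCoeff)`.

So BOTH lines of the `ℤ_p²`-tower now carry a proved analytic restriction, and a consumer of the Rubin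
road may put the anticyclotomic quotient in EITHER slot of `DualData₂` / `IsKatzMeasure₂` (the facts
`Rubin1991.thm41_…` / `thm53_…` quantify over all generator pairs): with `(κ₁, κ₂) = (κ_ac, κ₊)` the
OUTER variable is anticyclotomic and survives the algebraic descent `descent_iwasawaAlgebra`.

HONEST FRAMING: two unfolding lemmas; closes nothing by itself.
Reference: de Shalit 1987, II §4.17 (52)–(54) (p. 77–78).
-/

-- the summit namespace `Summit.BirchSwinnertonDyer.BirchSwinnertonDyer` repeats the problem name by design (D-0017)
set_option linter.dupNamespace false
set_option autoImplicit false

noncomputable section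

open scoped Classical

open NumberField IsDedekindDomain Field
  Literature.NumberTheory.GaloisRepresentations Literature.NumberTheory.EllipticCurves

namespace Summit.BirchSwinnertonDyer.BirchSwinnertonDyer.Theorems.IwasawaTwoVariable

universe u

section Restrict

variable {p : ℕ} [Fact p.Prime]

/-- **Restriction to the line `T₂ = 0`**: the value of `G ∈ 𝒪_{ℂ_p}⟦T₁⟧⟦T₂⟧` at `(x, 0)` is the value
at `x` of `G(T₁, 0) = PowerSeries.map PowerSeries.constantCoeff G ∈ 𝒪_{ℂ_p}⟦T₁⟧` (only the terms
`j = 0` of the double sum survive). Twin of `IntSeries.hasValueAt₂_zero_left_iff`.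
[cite: deShalit1987, II.4.17 (52)–(54) (p. 77–78)] -/
theorem hasValueAt₂_zero_right_iff (G : PowerSeries (PowerSeries (PadicComplexInt p)))
    (x v : ℂ_[p]) :
    IntSeries.HasValueAt₂ G x 0 v ↔
      IntSeries.HasValueAt (PowerSeries.map (PowerSeries.constantCoeff (R := PadicComplexInt p)) G)
        x v := by
  unfold IntSeries.HasValueAt₂ IntSeries.HasValueAt
  have hinj : Function.Injective (fun i : ℕ ↦ (i, (0 : ℕ))) := fun a b h ↦ by
    simpa using congrArg Prod.fst h
  rw [← hinj.hasSum_iff]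
  · refine Iff.of_eq (congrArg (fun f ↦ HasSum f v) ?_)
    funext i
    simp [Function.comp, PowerSeries.coeff_zero_eq_constantCoeff_apply, PowerSeries.coeff_map]
  · rintro ⟨i, j⟩ hij
    rcases j with _ | j
    · exact absurd ⟨i, rfl⟩ hij
    · simp

variable {K : Type u} [Field K] [NumberField K]
  {ι : PadicAlgCl p ≃+* ℂ} {v vbar : HeightOneSpectrum (𝓞 K)}
  {S : Finset (HeightOneSpectrum (𝓞 K))} {κ₁ κ₂ : ZpExtension K p} {γ₁ γ₂ : absoluteGaloisGroup K}
  {lam : HeckeCharacter K} {Ω δ : ℂ} {Ωp : ℂ_[p]} {G : PowerSeries (PowerSeries (PadicComplexInt p))}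

/-- **The two-variable frame restricts to the one-variable frame along the line `T₂ = 0`.** If `G` is
the `λ`-twisted branch of the two-variable Katz–de Shalit measure for `(κ₁, κ₂; γ₁, γ₂)` and
`κ₁(γ₂) = 0` (as in a generator pair), then `G(T₁, 0) = PowerSeries.map PowerSeries.constantCoeff G`
IS the `λ`-twisted `κ₁`-branch of the one-variable frame `DeShalit1987.IsKatzBranch` at the generator
`γ₁` (de Shalit II.4.17: (54) specialises to (52) at `s₂ = 0`). Twin of the typer's
`IsKatzMeasure₂.isKatzBranch_constantCoeff` (line `T₁ = 0`); the analytic half matching the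
algebraic descent `descent_iwasawaAlgebra` (which kills the inner variable).
[cite: deShalit1987, II.4.17 (52)–(54) (p. 77–78)] -/
theorem isKatzBranch_map_constantCoeff
    (hG : IsKatzMeasure₂ ι v vbar S κ₁ κ₂ γ₁ γ₂ lam Ω δ Ωp G) (hγ₂ : κ₁ γ₂ = 1) :
    DeShalit1987.IsKatzBranch ι v vbar S κ₁ γ₁ lam Ω δ Ωp
      (PowerSeries.map (PowerSeries.constantCoeff (R := PadicComplexInt p)) G) := by
  intro ρ r m j hr hκ hjm hinf hunr hL
  have h := hG.hasValueAt₂_zero_right hγ₂ hr hκ hjm hinf hunr hL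
  rw [hasValueAt₂_zero_right_iff] at h
  exact h

end Restrict

end Summit.BirchSwinnertonDyer.BirchSwinnertonDyer.Theorems.IwasawaTwoVariable

end
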